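import Literature.Computability.QuantumComplexity.GenKitFP
import Literature.Computability.QuantumComplexity.GenKitSizesFP
import Literature.Computability.QuantumComplexity.GRLevelProgFP
import Literature.Computability.QuantumComplexity.QFTKitSizesFP
import Literature.Computability.QuantumComplexity.GRData
import HarnessLib

/-!
# The kit parameters of both stages of Regev's sampler are polynomial-time computable

Topic `Literature/Computability/QuantumComplexity`; the S3/S4 kit inputs of the UNIFORMITY of Regev's sampler ([Regev2009,
Lemma 3.14, proof]; Arora–Barak §6.2): the abstract gate words of the Grover–Rudolph and Fourier stages are printed from the
parameter record `GP` of their kits (`GenKitAbstract.lean`, on codes in `GenKitFP.lean`: `GP.gopsA_fp`, `GP.GRA_fp`, …). Here the two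
records are computed on codes from the unary data:

* **`GenKit.gpOf_GR_codeFP hd hk : CodeFP eσ gpE (fun c => GenKit.gpOf (GRData.ps (kk c)) (dsz c) (kk c))`** — from
  `GRWord.prog_compile_codeFP` (`GRLevelProgFP.lean`) and the one-program sizes (`GenKitSizesFP.lean`);
* **`GenKit.bsize_GR_codeFP`** — the block size of the Grover–Rudolph kit;
* **`QFTKit.gpOf_codeFP hκ hk : CodeFP eσ gpE (fun c => QFTKit.gpOf (κ c) (k c))`** — from `QFTKit.qR/qF/qT_codeFP` (`QFTKitSizesFP.lean`).

Everything is proved; no named fact is introduced.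

## References

* O. Regev, J. ACM 56(6) (2009), Lemma 3.14 (proof) [Regev2009].
* S. Arora, B. Barak, *Computational Complexity: A Modern Approach*, CUP 2009, §6.2 [AroraBarak2009].
* D. Aharonov, V. Jones, Z. Landau, Algorithmica 55 (2009), §3.3 [AharonovJonesLandau2009].
-/

noncomputable section

namespace Literature.Computability.QuantumComplexity

open _root_.Computability Complexity Complexity.CodeFP SLP

variable {σ : Type} {eσ : σ → List Bool}

namespace GenKit

/-- The compiled level program, in a context. [folklore] -/
theorem prog_compile_codeFP_of {kk : σ → ℕ} (hk : CodeFP eσ unE kk) :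
    CodeFP eσ AJLCore.outBE (fun c => (GRWord.prog (kk c)).compile (thrWd (kk c)) 0 0) := (GRWord.prog_compile_codeFP.comp hk :)

/-- **The Grover–Rudolph kit record on codes**, from `(1^{dsz}, 1^{kk})` in a context. [cite: Regev2009, Lemma 3.14 (proof)]
[cite: AroraBarak2009, §6.2 (proof of Thm. 6.15)] -/
theorem gpOf_GR_codeFP {dsz kk : σ → ℕ} (hd : CodeFP eσ unE dsz) (hk : CodeFP eσ unE kk) :
    CodeFP eσ gpE (fun c => gpOf (GRData.ps (kk c)) (dsz c) (kk c)) :=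
  (GP.gpOf_codeFP hd hk (gR_codeFP_of hk (prog_compile_codeFP_of hk)) (gF_codeFP_of hk (prog_compile_codeFP_of hk))
    (gT_codeFP_of hk (prog_compile_codeFP_of hk))).congr fun _ => rfl

/-- **The Grover–Rudolph block size on codes.** [folklore] -/
theorem bsize_GR_codeFP {dsz kk : σ → ℕ} (hd : CodeFP eσ unE dsz) (hk : CodeFP eσ unE kk) :
    CodeFP eσ unE (fun c => bsize (GRData.ps (kk c)) (dsz c) (kk c)) :=
  (bsize_codeFP_of hd hk (prog_compile_codeFP_of hk)).congr fun _ => rfl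

end GenKit

namespace QFTKit

/-- **The Fourier kit record on codes**, from `(1^κ, 1ᵏ)` in a context. [cite: Regev2009, Lemma 3.14 (proof)]
[cite: AroraBarak2009, §6.2 (proof of Thm. 6.15)] -/
theorem gpOf_codeFP {κ k : σ → ℕ} (hκ : CodeFP eσ unE κ) (hk : CodeFP eσ unE k) :
    CodeFP eσ gpE (fun c => gpOf (κ c) (k c)) :=
  (GP.gpOf_codeFP hκ hk (qR_codeFP.comp (hk.pair hκ)) (qF_codeFP.comp (hk.pair hκ)) (qT_codeFP.comp (hk.pair hκ))).congr fun _ => rfl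

end QFTKit

end Literature.Computability.QuantumComplexity

end
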